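/-
Copyright: the b2b-balaban cell (near-miss cell 7), T⁴-continuum fan-out; row NE7b ROUND-2 swarm, seat
t4-ne7b-formalise-leaf-03 (gen 3) (row S12 «ASSEMBLY», repair row S12j «THRESHOLD-PAID MULTIPLICITY» of
`t4/b2b-balaban-t4-ne7b-p1/LEAVES-NE7b.md`, ruling R-OWNER-23-10 (2)(a) on finding F-leaf08g7-1).  Released under the
licence of the surrounding project.
-/
import Summits.QuantumFields.BalabanUV.T4Continuum.Support.HistoryAssemblyMult

/-!
# History assembly, multiplicity socket: THE CLASS-LINEAR SLACK PAID AT A PROFILE LEVEL (row S12j, part a)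

Summits-side support leaf of the T⁴-continuum cell (rung (B)+1 on a FINITE torus only; NOT infinite volume, NOT the
mass gap, NOT the Clay statement; NOT a proof of the spine estimate NE7b).  Row NE7b, route «COUNT», repair row S12j
(owner's ruling R-OWNER-23-10 on leaf-08 gen 7's finding F-leaf08g7-1: END OF RECORD v3's homing «θ slack-paid at
the profile FLOOR `p₀ ≥ 1`» demands `½γ₀A₁² > 8·8710^d` of print's O(1) constants — vacuous for O(1) constants).
[folklore] arithmetic over the lineage's OWN price letters (`HistoryConstantsTH.pshapeTH`, `HistoryAssemblyTerms.priceT`);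
nothing is quoted from print, nothing printed is asserted, no `[cite:]` tag, no definition, no `Prop` fact.

WHAT.  The three lemmas of `HistoryConstantsTH` §2b ∕ `HistoryAssemblyMult` §4 with the profile floor `1 ≤ p₀(g_step)`
REPLACED by a displayed profile LEVEL `P`, `1 ≤ P ≤ p₀(g_K(step))` at the member's birth steps, and the class-linear
factor allowed up to `e^{θ·P·birthLinT}`: `creditsT_slack_of_profile`, `pshapeTH_mul_exp_le_shapeTH_of_profile`,
**`card_mul_pshapeTH_le_priceT_of_profile`** (R-OWNER-23-10 (2)(a) verbatim: `hP : ∀ e ∈ q.2.events, (sh e).kind = 0 →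
P ≤ p0Profile C.A₀ C.p₀ (g K (sh e).step)`, `1 ≤ P`, `hN : N ≤ exp (θ * P * birthLinT sh q.2 + Ξ) * Λm ^ partnerAges …`).
The banked difference per unit of size is `(½γ₀A₁² − a)·p₀² ≥ (½γ₀A₁² − a)·P ≥ θ·P`; so ANY positive slack
`θ ≤ ½γ₀A₁² − a` affords row S6g′'s instance constant once `P` — the profile at the INFRARED THRESHOLD along
asymptotically free runs — is large: the demand moves from print's constants to the coupling window.

HONEST SCOPE.  Arithmetic only; `hslack` stays a displayed hypothesis (any positive slack); nothing of H3 ∕ (B) ∕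
BetaPertH touched; NE7b NOT proved.  HONEST DEPENDENCY (cell): continuum YM on T⁴ ⇐ BetaPertH ∧ nine spine estimates
(0/9 proved); BetaPertH ⇐ (D1) ∧ (D4) ∧ CAP+tail; G-an2-4 gates asym, D1 and NE2/3/4.  This file changes none of it.
-/

open Finset
open Literature.MathematicalPhysics.QuantumFieldTheory.Balaban1983to89
open T4PersistenceDictionary T4PersistentHistoryCount T4BankedInduction T4PrintedShapeBanking
open T4LiveClassFibration T4LiveStructureGas T4BranchingRecordsGas T4TaggedShapeBanking T4PartnerMultiplicity
open Summit.QuantumFields.BalabanUV.T4Continuum.LateMergers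
open Summit.QuantumFields.BalabanUV.T4Continuum.HistorySocketTH
open Summit.QuantumFields.BalabanUV.T4Continuum.HistoryAssemblyTerms
open Summit.QuantumFields.BalabanUV.T4Continuum.HistoryAssemblyTermsLE
open Summit.QuantumFields.BalabanUV.T4Continuum.HistoryConstants
open Summit.QuantumFields.BalabanUV.T4Continuum.HistoryAssemblyPrice
open Summit.QuantumFields.BalabanUV.T4Continuum.HistoryBankingLE
open Summit.QuantumFields.BalabanUV.T4Continuum.HistoryAssemblyMult

namespace Summit.QuantumFields.BalabanUV.T4Continuum.HistoryAssemblyMultProfile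

noncomputable section

/-! ## The class-linear slack paid AT A PROFILE LEVEL

`HistoryAssemblyMult.card_mul_pshapeTH_le_priceT` (§4 there) pays a multiplicity `e^{θ·birthLinT}` out of the CONSTANT slack `C.a + θ ≤ ½γ₀A₁²` at the profile FLOOR `p₀ ≥ 1`; with
`θ` as large as row S6g′'s instance needs, that demands `½γ₀A₁² > 8·8710^d` of print's O(1)'s (finding F-leaf08g7-1,
leaf-08 gen 7) — vacuous for O(1) constants.  Print pays combinatorial factors `e^{O(1)|X|}` by `e^{−p₀(g_k)|X|}` with
`p₀(g_k) → ∞` in the coupling window; here: the same banked difference read at a displayed profile LEVEL `P` with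
`1 ≤ P ≤ p₀(g_K(step))` at the members' birth steps pays `e^{θ·P·birthLinT}` — ANY positive slack `θ` then affords the
instance's constant once `P` (the infrared threshold) is large.  [folklore] -/

section Profile

variable {ε γ : Type*} [DecidableEq ε] {C : T4PrintedShapeBanking.Consts} {O : PrintedO1s}

/-- **CREDIT SLACK AT A PROFILE LEVEL**: with `C.a + θ ≤ ½γ₀A₁²`, `θ ≥ 0`, `1 ≤ P` and `P ≤ p₀(g_step)` at the
genealogy's birth steps, print's credits exceed the model's by at least `θ·P·birthLinT` (per unit of size the banked
difference is `(½γ₀A₁² − a)·p₀² ≥ (½γ₀A₁² − a)·P ≥ θ·P`). [folklore] -/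
theorem creditsT_slack_of_profile (sh : ε → PEv) {θ P : ℝ} (hθ : 0 ≤ θ) (hslack : C.a + θ ≤ O.γ₀ * O.A₁ ^ 2 / 2)
    (hP1 : 1 ≤ P) (g : ℕ → ℝ) {G : Gen ε}
    (hP : ∀ e ∈ G.events, (sh e).kind = 0 → P ≤ p0Profile C.A₀ C.p₀ (g (sh e).step)) :
    credits (credit C g ∘ sh) G + θ * P * birthLinT sh G ≤ credits (pcredit O C g ∘ sh) G := by
  unfold credits birthLinT
  rw [Finset.sum_filter, Finset.mul_sum, ← Finset.sum_add_distrib]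
  refine Finset.sum_le_sum fun e he => ?_
  simp only [Function.comp_apply]
  by_cases h0 : (sh e).kind = 0
  · rw [if_pos h0, credit_kind0 h0, pcredit_kind0 h0]
    have h1 : P ≤ p0Profile C.A₀ C.p₀ (g (sh e).step) := hP e he h0
    have hp1 : 1 ≤ p0Profile C.A₀ C.p₀ (g (sh e).step) := hP1.trans h1
    have hsq : P ≤ p0Profile C.A₀ C.p₀ (g (sh e).step) ^ 2 := by nlinarith
    have hf : (0 : ℝ) ≤ ((sh e).fat : ℝ) + 1 := by positivity
    have hσ : θ * P ≤ (O.γ₀ * O.A₁ ^ 2 / 2 - C.a) * p0Profile C.A₀ C.p₀ (g (sh e).step) ^ 2 := by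
      nlinarith [mul_le_mul_of_nonneg_left hsq hθ]
    nlinarith [mul_le_mul_of_nonneg_right hσ hf]
  · rw [if_neg h0, mul_zero, add_zero]
    by_cases h1 : (sh e).kind = 1
    · rw [credit_kind1 h1, pcredit_kind1 h1]
    · have h2 : (sh e).kind = 2 := by
        generalize hk : (sh e).kind = k at h0 h1 ⊢
        fin_cases k <;> simp_all
      rw [credit_kind2 h2, pcredit_kind2 h2]

/-- **PRINT-PRICED TH SHAPE × CLASS-LINEAR FACTOR AT LEVEL `P` ≤ THE TH EXIT'S SHAPE** (as
`HistoryConstants.pshapeTH_mul_exp_le_shapeTH_of_slack`, the factor being `e^{θ·P·birthLinT}`). [folklore] -/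
theorem pshapeTH_mul_exp_le_shapeTH_of_profile (sh : ε → PEv) {θ P : ℝ} (hθ : 0 ≤ θ)
    (hslack : C.a + θ ≤ O.γ₀ * O.A₁ ^ 2 / 2) (hP1 : 1 ≤ P) {Δ Λ' : ℝ} (hΔ : 0 ≤ Δ) (hΛ : 0 ≤ Λ')
    (R : ℕ → ℕ) (g : ℕ → ℝ) (K D : ℕ) {κ : Gen ε → ℕ → ℝ} {G : Gen ε}
    (hP : ∀ e ∈ G.events, (sh e).kind = 0 → P ≤ p0Profile C.A₀ C.p₀ (g (sh e).step))
    (h : ∀ n ∈ life (padW (dictWT sh R C.n₁) D) G, κ G n ≤ costT sh C K R G n) :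
    pshapeTH sh O C Δ Λ' R g D κ G * Real.exp (θ * P * birthLinT sh G) ≤
      HistoryConstants.shapeTH sh C Δ Λ' R g K D G := by
  unfold pshapeTH HistoryConstants.shapeTH
  have hc : Real.exp (-credits (pcredit O C g ∘ sh) G) * Real.exp (θ * P * birthLinT sh G) ≤
      Real.exp (-credits (credit C g ∘ sh) G) := by
    rw [← Real.exp_add]
    exact Real.exp_le_exp.2 (by linarith [creditsT_slack_of_profile sh hθ hslack hP1 g hP])
  have hl : Real.exp (lifeCost (padW (dictWT sh R C.n₁) D) κ G) ≤
      Real.exp (lifeCost (padW (dictWT sh R C.n₁) D) (costT sh C K R) G) :=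
    Real.exp_le_exp.2 (lifeCostT_mono h)
  have hraw : Real.exp (-credits (pcredit O C g ∘ sh) G) * Real.exp (lifeCost (padW (dictWT sh R C.n₁) D) κ G) *
      Real.exp (θ * P * birthLinT sh G) ≤ Real.exp (-credits (credit C g ∘ sh) G) *
        Real.exp (lifeCost (padW (dictWT sh R C.n₁) D) (costT sh C K R) G) := by
    calc _ = Real.exp (-credits (pcredit O C g ∘ sh) G) * Real.exp (θ * P * birthLinT sh G) *
          Real.exp (lifeCost (padW (dictWT sh R C.n₁) D) κ G) := by ring
      _ ≤ _ := mul_le_mul hc hl (Real.exp_pos _).le (Real.exp_pos _).le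
  have hpre : 0 ≤ Δ * Λ' ^ partnerAges (PEv.step ∘ sh) G := mul_nonneg hΔ (pow_nonneg hΛ _)
  calc _ = Δ * Λ' ^ partnerAges (PEv.step ∘ sh) G * (Real.exp (-credits (pcredit O C g ∘ sh) G) *
        Real.exp (lifeCost (padW (dictWT sh R C.n₁) D) κ G) * Real.exp (θ * P * birthLinT sh G)) := by ring
    _ ≤ Δ * Λ' ^ partnerAges (PEv.step ∘ sh) G * (Real.exp (-credits (credit C g ∘ sh) G) *
        Real.exp (lifeCost (padW (dictWT sh R C.n₁) D) (costT sh C K R) G)) :=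
      mul_le_mul_of_nonneg_left hraw hpre
    _ = _ := by ring

/-- **MULTIPLICITY × DISCOUNTED PRINTED PRICE ≤ TREE-SLOT PRICE, THE SLACK READ AT A PROFILE LEVEL `P`** (row S12j,
R-OWNER-23-10 (2)(a)): as `card_mul_pshapeTH_le_priceT` with the profile floor `1 ≤ p₀` replaced by a displayed level
`1 ≤ P ≤ p₀(g_K(step))` at the member's birth steps and the multiplicity allowed up to
`e^{θ·P·birthLinT sh G′ + Ξ}·Λm^{partnerAges}`. [folklore] -/
theorem card_mul_pshapeTH_le_priceT_of_profile (sh : ε → PEv) {θ P Λm Λr Λ' : ℝ} (hθ : 0 ≤ θ)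
    (hslack : C.a + θ ≤ O.γ₀ * O.A₁ ^ 2 / 2) (hP1 : 1 ≤ P) (hΛm : 0 ≤ Λm) (hΛr : 0 ≤ Λr) (hΛ : Λm * Λr ≤ Λ')
    (R : ℕ → ℕ → ℕ) (g : ℕ → ℕ → ℝ) (K : ℕ) {q : γ × Gen ε} {κ : Gen ε → ℕ → ℝ} {N Ξ : ℝ}
    (hP : ∀ e ∈ q.2.events, (sh e).kind = 0 → P ≤ p0Profile C.A₀ C.p₀ (g K (sh e).step))
    (hκ : ∀ n ∈ life (padW (dictWT sh (R K) C.n₁) 0) q.2, κ q.2 n ≤ costT sh C K (R K) q.2 n)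
    (hN : N ≤ Real.exp (θ * P * birthLinT sh q.2 + Ξ) * Λm ^ partnerAges (PEv.step ∘ sh) q.2) :
    N * (pshapeTH sh O C 1 Λr (R K) (g K) 0 κ q.2 * Real.exp (-Ξ)) ≤ priceT sh C Λ' R g K q := by
  have hps : 0 ≤ pshapeTH sh O C 1 Λr (R K) (g K) 0 κ q.2 := pshapeTH_nonneg sh zero_le_one hΛr _ _ _ _ _
  have h1 : N * (pshapeTH sh O C 1 Λr (R K) (g K) 0 κ q.2 * Real.exp (-Ξ)) ≤
      Real.exp (θ * P * birthLinT sh q.2 + Ξ) * Λm ^ partnerAges (PEv.step ∘ sh) q.2 *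
        (pshapeTH sh O C 1 Λr (R K) (g K) 0 κ q.2 * Real.exp (-Ξ)) :=
    mul_le_mul_of_nonneg_right hN (mul_nonneg hps (Real.exp_pos _).le)
  have h2 : Real.exp (θ * P * birthLinT sh q.2 + Ξ) * Λm ^ partnerAges (PEv.step ∘ sh) q.2 *
      (pshapeTH sh O C 1 Λr (R K) (g K) 0 κ q.2 * Real.exp (-Ξ)) =
      Λm ^ partnerAges (PEv.step ∘ sh) q.2 *
        (pshapeTH sh O C 1 Λr (R K) (g K) 0 κ q.2 * Real.exp (θ * P * birthLinT sh q.2)) := by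
    have e : Real.exp (θ * P * birthLinT sh q.2 + Ξ) * Real.exp (-Ξ) = Real.exp (θ * P * birthLinT sh q.2) := by
      rw [← Real.exp_add, add_neg_cancel_right]
    calc _ = Λm ^ partnerAges (PEv.step ∘ sh) q.2 * (pshapeTH sh O C 1 Λr (R K) (g K) 0 κ q.2 *
          (Real.exp (θ * P * birthLinT sh q.2 + Ξ) * Real.exp (-Ξ))) := by ring
      _ = _ := by rw [e]
  have h3 : pshapeTH sh O C 1 Λr (R K) (g K) 0 κ q.2 * Real.exp (θ * P * birthLinT sh q.2) ≤
      HistoryConstants.shapeTH sh C 1 Λr (R K) (g K) K 0 q.2 :=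
    pshapeTH_mul_exp_le_shapeTH_of_profile sh hθ hslack hP1 zero_le_one hΛr (R K) (g K) K 0 hP hκ
  have hE : 0 ≤ Real.exp (-credits (credit C (g K) ∘ sh) q.2) *
      Real.exp (lifeCost (dictWT sh (R K) C.n₁) (costT sh C K (R K)) q.2) := by positivity
  have h4 : Λm ^ partnerAges (PEv.step ∘ sh) q.2 * HistoryConstants.shapeTH sh C 1 Λr (R K) (g K) K 0 q.2 ≤
      priceT sh C Λ' R g K q := by
    rw [shapeTH_zero_one, priceT, ← mul_assoc, ← mul_pow]
    exact mul_le_mul_of_nonneg_right (pow_le_pow_left₀ (mul_nonneg hΛm hΛr) hΛ _) hE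
  calc _ ≤ _ := h1
    _ = _ := h2
    _ ≤ Λm ^ partnerAges (PEv.step ∘ sh) q.2 * HistoryConstants.shapeTH sh C 1 Λr (R K) (g K) K 0 q.2 :=
      mul_le_mul_of_nonneg_left h3 (pow_nonneg hΛm _)
    _ ≤ _ := h4

end Profile

end

end Summit.QuantumFields.BalabanUV.T4Continuum.HistoryAssemblyMultProfile
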